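import Summits.ValiantsHypothesis.ValiantsHypothesis.Theses.RealTau
import Literature.Computability.AlgebraicComplexity.RealTauKnownCases
import Summits.ValiantsHypothesis.ValiantsHypothesis.Theorems.RealTauRealTauRefinedWaringFixedK

/-!
# Crux `RealTau.RealTauRefined` (stmt-ValiantsHypothesis-18101), line `fischer-powers` —
# three powers: the exponent `m` enters the zero count only through ONE `m`-free polynomial

For the open core `stub_waringCore` at `K = 3` this file isolates the `m`-dependence completely.
With `W = Polynomial.wronskian` (`W(a,b) = a b' - a' b`) and the explicit `3 × 3` Wronskian
`W₃(f,g,h) = f (g'h'' - g''h') - g (f'h'' - f''h') + h (f'g'' - f''g)`: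

* `wronskian_wronskian` : `W(W(f,g), W(f,h)) = f · W₃(f,g,h)` (classical);
* `card_roots_add_add_le` (Voorhoeve–van der Poorten / KPT15 Thm 9 for three terms, via the landed
  quotient form of Rolle `card_roots_le_rolle_wronskian` twice):
  `#roots(f₁+f₂+f₃) ≤ 3 #roots f₁ + 2 #roots W(f₁,f₂) + #roots W(f₁,f₃) + #roots W₃(f₁,f₂,f₃) + 2`;
* `wronskian3_pow` (THE PENCIL IDENTITY): `W₃(h₁^(n+2), h₂^(n+2), h₃^(n+2)) =
  (n+2)² (h₁h₂h₃)^n · ((n+1)·W₁₂W₁₃W₂₃ + h₁h₂h₃·W₃(h₁,h₂,h₃))` — the exponent enters LINEARLY, in a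
  pencil of two exponent-free polynomials `U = W₁₂W₁₃W₂₃` (a Veronese determinant) and `V = h₁h₂h₃W₃`;
* `waring_three_card_roots_le_mfree` : for `G = ε₁h₁^m + ε₂h₂^m + ε₃h₃^m ≠ 0` (`m ≥ 2`, `ε₁, h₁ ≠ 0`),
  `#roots G ≤ 8 #roots h₁ + 4 #roots h₂ + 3 #roots h₃ + 2 #roots W₁₂ + #roots W₁₃ + 2 #roots U + #roots W(U,V)
  + #roots W₃(h₁,h₂,h₃) + 3` — EVERY term independent of `m` (the pencil is handled by Rolle in quotient
  form: `#roots((n+1)U + V) ≤ 2 #roots U + #roots W(U,V) + 1` for every `n`).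

So `m`-uniformity at `K = 3` (known numerically as `(T+3)^125` from `WaringFixedK`, `T^{O(27)}` in
KPT15) is the statement that ONE exponent-free polynomial `W(U,V)` built from `h₁,h₂,h₃` has few zeros;
for `T`-sparse `h_i` each displayed term is Descartes-bounded, and the Wronskian factors `W_ij` even by
`2(T-2)` (Saldanha–Shapiro–Shapiro 2021, Grassmann convexity for `k = 2`, not formalised here).
Calibration / structure theorem for the line, landed `--supports`.
-/

noncomputable section

-- single-conjunct layout: Sub = Summit, duplicated namespace component intended
set_option linter.dupNamespace false

namespace Summit.ValiantsHypothesis.ValiantsHypothesis.Theorems.RealTauRealTauRefined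

open Polynomial Finset
open Literature.Computability.AlgebraicComplexity

/-- `W(W(f,g), W(f,h)) = f · W₃(f,g,h)` with the `3 × 3` Wronskian written out. [folklore] -/
theorem wronskian_wronskian (f g h : ℝ[X]) :
    wronskian (wronskian f g) (wronskian f h) =
      f * (f * (derivative g * derivative (derivative h) - derivative (derivative g) * derivative h)
        - g * (derivative f * derivative (derivative h) - derivative (derivative f) * derivative h)
        + h * (derivative f * derivative (derivative g) - derivative (derivative f) * derivative g)) := by
  simp only [wronskian, derivative_mul, derivative_sub]
  ring

/-- **Three-term Voorhoeve–van der Poorten bound** (KPT15 Thm 9, `k = 3`), for real polynomials: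
`#roots(f₁+f₂+f₃) ≤ 3 #roots f₁ + 2 #roots W(f₁,f₂) + #roots W(f₁,f₃) + #roots W₃(f₁,f₂,f₃) + 2`
(distinct real roots; `f₁ ≠ 0`, `f₁+f₂+f₃ ≠ 0`).  Two quotient-Rolle steps: divide by `f₁`
(`W(f₁, f₁+f₂+f₃) = W₁₂ + W₁₃`), then by `W₁₂` (`W(W₁₂, W₁₂+W₁₃) = f₁ W₃`). [folklore] -/
theorem card_roots_add_add_le (f₁ f₂ f₃ : ℝ[X]) (h₁ : f₁ ≠ 0) (hG : f₁ + f₂ + f₃ ≠ 0) :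
    (f₁ + f₂ + f₃).roots.toFinset.card ≤
      3 * f₁.roots.toFinset.card + 2 * (wronskian f₁ f₂).roots.toFinset.card
        + (wronskian f₁ f₃).roots.toFinset.card
        + (f₁ * (derivative f₂ * derivative (derivative f₃) - derivative (derivative f₂) * derivative f₃)
            - f₂ * (derivative f₁ * derivative (derivative f₃) - derivative (derivative f₁) * derivative f₃)
            + f₃ * (derivative f₁ * derivative (derivative f₂) - derivative (derivative f₁) * derivative f₂)
            ).roots.toFinset.card + 2 := by
  classical
  set W3 := f₁ * (derivative f₂ * derivative (derivative f₃) - derivative (derivative f₂) * derivative f₃)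
      - f₂ * (derivative f₁ * derivative (derivative f₃) - derivative (derivative f₁) * derivative f₃)
      + f₃ * (derivative f₁ * derivative (derivative f₂) - derivative (derivative f₁) * derivative f₂)
    with hW3
  -- step 1
  have s1 := card_roots_le_rolle_wronskian (f₁ + f₂ + f₃) f₁ hG h₁
  have hH : wronskian f₁ (f₁ + f₂ + f₃) = wronskian f₁ f₂ + wronskian f₁ f₃ := by
    rw [wronskian_add_right, wronskian_add_right, wronskian_self_eq_zero, zero_add]
  rw [hH] at s1
  -- step 2: bound the roots of `H = W₁₂ + W₁₃`
  have s2 : (wronskian f₁ f₂ + wronskian f₁ f₃).roots.toFinset.card ≤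
      2 * (wronskian f₁ f₂).roots.toFinset.card + (wronskian f₁ f₃).roots.toFinset.card
        + f₁.roots.toFinset.card + W3.roots.toFinset.card + 1 := by
    by_cases hH0 : wronskian f₁ f₂ + wronskian f₁ f₃ = 0
    · rw [hH0, roots_zero, Multiset.toFinset_zero, card_empty]; exact Nat.zero_le _
    by_cases h12 : wronskian f₁ f₂ = 0
    · rw [h12, zero_add, roots_zero, Multiset.toFinset_zero, card_empty]; omega
    have s := card_roots_le_rolle_wronskian _ _ hH0 h12
    have hid : wronskian (wronskian f₁ f₂) (wronskian f₁ f₂ + wronskian f₁ f₃) = f₁ * W3 := by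
      rw [wronskian_add_right, wronskian_self_eq_zero, zero_add, hW3, wronskian_wronskian]
    rw [hid] at s
    have hm := card_roots_toFinset_mul_le f₁ W3
    omega
  omega

/-- **The pencil identity.**  For the explicit `3 × 3` Wronskian `W₃` and `W_ij = W(h_i,h_j)`:
`W₃(h₁^(n+2), h₂^(n+2), h₃^(n+2)) = (n+2)² (h₁h₂h₃)^n ((n+1) W₁₂W₁₃W₂₃ + h₁h₂h₃ W₃(h₁,h₂,h₃))` —
the exponent enters only linearly (the coefficient `W₁₂W₁₃W₂₃` is the Veronese determinant
`det[h_i², h_ih_i', h_i'²] = Π_{i<j} W_ij`). [folklore] -/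
theorem wronskian3_pow (h₁ h₂ h₃ : ℝ[X]) (n : ℕ) :
    (h₁ ^ (n + 2) * (derivative (h₂ ^ (n + 2)) * derivative (derivative (h₃ ^ (n + 2)))
        - derivative (derivative (h₂ ^ (n + 2))) * derivative (h₃ ^ (n + 2)))
      - h₂ ^ (n + 2) * (derivative (h₁ ^ (n + 2)) * derivative (derivative (h₃ ^ (n + 2)))
        - derivative (derivative (h₁ ^ (n + 2))) * derivative (h₃ ^ (n + 2)))
      + h₃ ^ (n + 2) * (derivative (h₁ ^ (n + 2)) * derivative (derivative (h₂ ^ (n + 2)))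
        - derivative (derivative (h₁ ^ (n + 2))) * derivative (h₂ ^ (n + 2)))) =
    ((n : ℝ[X]) + 2) ^ 2 * (h₁ * h₂ * h₃) ^ n *
      (((n : ℝ[X]) + 1) * (wronskian h₁ h₂ * wronskian h₁ h₃ * wronskian h₂ h₃)
        + h₁ * h₂ * h₃ *
          (h₁ * (derivative h₂ * derivative (derivative h₃) - derivative (derivative h₂) * derivative h₃)
            - h₂ * (derivative h₁ * derivative (derivative h₃) - derivative (derivative h₁) * derivative h₃)
            + h₃ * (derivative h₁ * derivative (derivative h₂) - derivative (derivative h₁) * derivative h₂))) := by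
  have e1 : ∀ p : ℝ[X], derivative (p ^ (n + 2)) = ((n : ℝ[X]) + 2) * p ^ (n + 1) * derivative p := by
    intro p
    rw [show n + 2 = (n + 1) + 1 by ring, derivative_pow_succ]
    simp only [map_add, map_natCast, map_one, Nat.cast_add, Nat.cast_one]
    ring
  have e2 : ∀ p : ℝ[X], derivative (derivative (p ^ (n + 2))) =
      ((n : ℝ[X]) + 2) * (((n : ℝ[X]) + 1) * p ^ n * derivative p * derivative p
        + p ^ (n + 1) * derivative (derivative p)) := by
    intro p
    rw [e1, derivative_mul, derivative_mul, derivative_pow_succ]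
    simp only [map_add, map_natCast, map_one, derivative_natCast, derivative_ofNat,
      add_zero, zero_mul, zero_add]
    ring
  simp only [e2]
  simp only [e1, wronskian]
  ring

/-- Wronskian of two scaled powers: `W(a p^(n+1), b q^(n+1)) = (a b (n+1)) (p q)^n W(p,q)`. [folklore] -/
theorem wronskian_C_mul_pow_succ (a b : ℝ) (p q : ℝ[X]) (n : ℕ) :
    wronskian (C a * p ^ (n + 1)) (C b * q ^ (n + 1)) =
      C (a * b * ((n : ℝ) + 1)) * (p * q) ^ n * wronskian p q := by
  simp only [wronskian, derivative_mul, derivative_C, zero_mul, zero_add, derivative_pow_succ, map_mul,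
    map_add, map_natCast, map_one]
  ring

/-- **`K = 3`: the exponent is carried by one exponent-free polynomial.**  Let `h₁, h₂, h₃ ∈ ℝ[X]`,
`ε₁ ε₂ ε₃ ∈ ℝ` with `ε₁ ≠ 0`, `h₁ ≠ 0`, and `m ≥ 2`; put `W_ij = W(h_i, h_j)`, `U = W₁₂ W₁₃ W₂₃`,
`V = h₁h₂h₃ · W₃(h₁,h₂,h₃)`.  If `G = ε₁h₁^m + ε₂h₂^m + ε₃h₃^m ≠ 0` then
`#roots G ≤ 8 #roots h₁ + 4 #roots h₂ + 3 #roots h₃ + 2 #roots W₁₂ + #roots W₁₃ + 2 #roots U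
 + #roots W(U,V) + #roots W₃(h₁,h₂,h₃) + 3`, a bound in which `m` does not occur.
(`card_roots_add_add_le` + `wronskian3_pow` + Rolle in quotient form on the pencil `(m-1)U + V`.)
[folklore; structure behind Koiran–Portier–Tavenas 2015 Thm 12 at `k = 3`] -/
theorem waring_three_card_roots_le_mfree' (h₁ h₂ h₃ : ℝ[X]) (ε₁ ε₂ ε₃ : ℝ) (hε₁ : ε₁ ≠ 0)
    (hh₁ : h₁ ≠ 0) (m : ℕ) (hm : 2 ≤ m)
    (hG : C ε₁ * h₁ ^ m + C ε₂ * h₂ ^ m + C ε₃ * h₃ ^ m ≠ 0) :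
    (C ε₁ * h₁ ^ m + C ε₂ * h₂ ^ m + C ε₃ * h₃ ^ m).roots.toFinset.card ≤
      8 * h₁.roots.toFinset.card + 4 * h₂.roots.toFinset.card + 3 * h₃.roots.toFinset.card
      + 2 * (wronskian h₁ h₂).roots.toFinset.card + (wronskian h₁ h₃).roots.toFinset.card
      + 2 * (wronskian h₁ h₂ * wronskian h₁ h₃ * wronskian h₂ h₃).roots.toFinset.card
      + (wronskian (wronskian h₁ h₂ * wronskian h₁ h₃ * wronskian h₂ h₃)
          (h₁ * h₂ * h₃ *
            (h₁ * (derivative h₂ * derivative (derivative h₃) - derivative (derivative h₂) * derivative h₃)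
              - h₂ * (derivative h₁ * derivative (derivative h₃) - derivative (derivative h₁) * derivative h₃)
              + h₃ * (derivative h₁ * derivative (derivative h₂) - derivative (derivative h₁) * derivative h₂)))
          ).roots.toFinset.card
      + (h₁ * (derivative h₂ * derivative (derivative h₃) - derivative (derivative h₂) * derivative h₃)
          - h₂ * (derivative h₁ * derivative (derivative h₃) - derivative (derivative h₁) * derivative h₃)
          + h₃ * (derivative h₁ * derivative (derivative h₂) - derivative (derivative h₁) * derivative h₂)
          ).roots.toFinset.card + 3 := by
  classical
  -- names
  set W3 := h₁ * (derivative h₂ * derivative (derivative h₃) - derivative (derivative h₂) * derivative h₃)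
      - h₂ * (derivative h₁ * derivative (derivative h₃) - derivative (derivative h₁) * derivative h₃)
      + h₃ * (derivative h₁ * derivative (derivative h₂) - derivative (derivative h₁) * derivative h₂)
    with hW3
  set U := wronskian h₁ h₂ * wronskian h₁ h₃ * wronskian h₂ h₃ with hU
  set V := h₁ * h₂ * h₃ * W3 with hV
  obtain ⟨n, rfl⟩ : ∃ n, m = n + 2 := ⟨m - 2, by omega⟩
  set f₁ := C ε₁ * h₁ ^ (n + 2) with hf₁
  set f₂ := C ε₂ * h₂ ^ (n + 2) with hf₂
  set f₃ := C ε₃ * h₃ ^ (n + 2) with hf₃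
  have hf₁0 : f₁ ≠ 0 := mul_ne_zero (C_ne_zero.mpr hε₁) (pow_ne_zero _ hh₁)
  -- generic facts
  have ZC : ∀ (c : ℝ) (P : ℝ[X]), (C c * P).roots.toFinset.card ≤ P.roots.toFinset.card := by
    intro c P
    refine (card_roots_toFinset_mul_le _ _).trans ?_
    rw [roots_C, Multiset.toFinset_zero, card_empty, zero_add]
  have Znat : ∀ (k : ℕ) (P : ℝ[X]), (((k : ℝ[X]) + 2) ^ 2 * P).roots.toFinset.card ≤
      P.roots.toFinset.card := by
    intro k P
    have : ((k : ℝ[X]) + 2) ^ 2 = C (((k : ℝ) + 2) ^ 2) := by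
      simp only [map_pow, map_add, map_natCast, map_ofNat]
    rw [this]; exact ZC _ _
  have Zpow : ∀ (P : ℝ[X]) (k : ℕ), (P ^ k).roots.toFinset.card ≤ P.roots.toFinset.card :=
    fun P k => card_roots_toFinset_pow_le P k
  have Z3 : ∀ k : ℕ, ((h₁ * h₂ * h₃) ^ k).roots.toFinset.card ≤
      h₁.roots.toFinset.card + h₂.roots.toFinset.card + h₃.roots.toFinset.card := fun k =>
    (Zpow _ k).trans ((card_roots_toFinset_mul_le _ _).trans
      (Nat.add_le_add_right (card_roots_toFinset_mul_le _ _) _))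
  -- the two pairwise Wronskians
  have hW12 : (wronskian f₁ f₂).roots.toFinset.card ≤
      h₁.roots.toFinset.card + h₂.roots.toFinset.card + (wronskian h₁ h₂).roots.toFinset.card := by
    rw [hf₁, hf₂, wronskian_C_mul_pow_succ]
    refine (card_roots_toFinset_mul_le _ _).trans (Nat.add_le_add_right ?_ _)
    refine (ZC _ _).trans ((Zpow _ _).trans (card_roots_toFinset_mul_le _ _))
  have hW13 : (wronskian f₁ f₃).roots.toFinset.card ≤
      h₁.roots.toFinset.card + h₃.roots.toFinset.card + (wronskian h₁ h₃).roots.toFinset.card := by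
    rw [hf₁, hf₃, wronskian_C_mul_pow_succ]
    refine (card_roots_toFinset_mul_le _ _).trans (Nat.add_le_add_right ?_ _)
    refine (ZC _ _).trans ((Zpow _ _).trans (card_roots_toFinset_mul_le _ _))
  -- the 3 × 3 Wronskian of the powers, through the pencil identity
  have hW3f : (f₁ * (derivative f₂ * derivative (derivative f₃) - derivative (derivative f₂) * derivative f₃)
      - f₂ * (derivative f₁ * derivative (derivative f₃) - derivative (derivative f₁) * derivative f₃)
      + f₃ * (derivative f₁ * derivative (derivative f₂) - derivative (derivative f₁) * derivative f₂)) =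
      C (ε₁ * ε₂ * ε₃) * (((n : ℝ[X]) + 2) ^ 2 * ((h₁ * h₂ * h₃) ^ n * (((n : ℝ[X]) + 1) * U + V))) := by
    have key := wronskian3_pow h₁ h₂ h₃ n
    rw [hf₁, hf₂, hf₃]
    simp only [derivative_mul, derivative_C, zero_mul, zero_add, map_mul]
    rw [hU, hV, hW3]
    linear_combination (C ε₁ * C ε₂ * C ε₃) * key
  have hpencil : (((n : ℝ[X]) + 1) * U + V).roots.toFinset.card ≤
      2 * U.roots.toFinset.card + (wronskian U V).roots.toFinset.card + 1
        + (h₁.roots.toFinset.card + h₂.roots.toFinset.card + h₃.roots.toFinset.card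
            + W3.roots.toFinset.card) := by
    by_cases hP : ((n : ℝ[X]) + 1) * U + V = 0
    · rw [hP, roots_zero, Multiset.toFinset_zero, card_empty]; exact Nat.zero_le _
    by_cases hU0 : U = 0
    · have : ((n : ℝ[X]) + 1) * U + V = V := by rw [hU0, mul_zero, zero_add]
      rw [this, hV]
      have := (card_roots_toFinset_mul_le (h₁ * h₂ * h₃) W3).trans
        (Nat.add_le_add_right ((card_roots_toFinset_mul_le _ _).trans
          (Nat.add_le_add_right (card_roots_toFinset_mul_le _ _) _)) _)
      omega
    have s := card_roots_le_rolle_wronskian _ U hP hU0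
    have hid : wronskian U (((n : ℝ[X]) + 1) * U + V) = wronskian U V := by
      rw [wronskian_add_right]
      have : wronskian U (((n : ℝ[X]) + 1) * U) = 0 := by
        simp only [wronskian, derivative_mul, derivative_add, derivative_natCast, derivative_one,
          add_zero, zero_mul, zero_add]
        ring
      rw [this, zero_add]
    rw [hid] at s
    omega
  have hW3bound : (f₁ * (derivative f₂ * derivative (derivative f₃) - derivative (derivative f₂) * derivative f₃)
      - f₂ * (derivative f₁ * derivative (derivative f₃) - derivative (derivative f₁) * derivative f₃)
      + f₃ * (derivative f₁ * derivative (derivative f₂) - derivative (derivative f₁) * derivative f₂)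
      ).roots.toFinset.card ≤
      (h₁.roots.toFinset.card + h₂.roots.toFinset.card + h₃.roots.toFinset.card)
        + (2 * U.roots.toFinset.card + (wronskian U V).roots.toFinset.card + 1
            + (h₁.roots.toFinset.card + h₂.roots.toFinset.card + h₃.roots.toFinset.card
                + W3.roots.toFinset.card)) := by
    rw [hW3f]
    refine (ZC _ _).trans ((Znat n _).trans ((card_roots_toFinset_mul_le _ _).trans
      (Nat.add_le_add (Z3 n) hpencil)))
  -- assemble
  have main := card_roots_add_add_le f₁ f₂ f₃ hf₁0 hG
  have hZf₁ : f₁.roots.toFinset.card ≤ h₁.roots.toFinset.card := (ZC _ _).trans (Zpow _ _)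
  omega

/-- **Registered form** of `waring_three_card_roots_le_mfree'` (sub-goal of `stub_waringCore`,
line `fischer-powers`): the `K = 3` zero count is bounded by exponent-free quantities. [folklore] -/
theorem waring_three_card_roots_le_mfree : ∀ (h₁ h₂ h₃ : Polynomial ℝ) (ε₁ ε₂ ε₃ : ℝ), ε₁ ≠ 0 → h₁ ≠ 0 → ∀ (m : ℕ), 2 ≤ m → C ε₁ * h₁ ^ m + C ε₂ * h₂ ^ m + C ε₃ * h₃ ^ m ≠ 0 → (C ε₁ * h₁ ^ m + C ε₂ * h₂ ^ m + C ε₃ * h₃ ^ m).roots.toFinset.card ≤ 8 * h₁.roots.toFinset.card + 4 * h₂.roots.toFinset.card + 3 * h₃.roots.toFinset.card + 2 * (wronskian h₁ h₂).roots.toFinset.card + (wronskian h₁ h₃).roots.toFinset.card + 2 * (wronskian h₁ h₂ * wronskian h₁ h₃ * wronskian h₂ h₃).roots.toFinset.card + (wronskian (wronskian h₁ h₂ * wronskian h₁ h₃ * wronskian h₂ h₃) (h₁ * h₂ * h₃ * (h₁ * (derivative h₂ * derivative (derivative h₃) - derivative (derivative h₂) * derivative h₃) - h₂ * (derivative h₁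 * derivative (derivative h₃) - derivative (derivative h₁) * derivative h₃) + h₃ * (derivative h₁ * derivative (derivative h₂) - derivative (derivative h₁) * derivative h₂)))).roots.toFinset.card + (h₁ * (derivative h₂ * derivative (derivative h₃) - derivative (derivative h₂) * derivative h₃) - h₂ * (derivative h₁ * derivative (derivative h₃) - derivative (derivative h₁) * derivative h₃) + h₃ * (derivative h₁ * derivative (derivative h₂) - derivative (derivative h₁) * derivative h₂)).roots.toFinset.card + 3 :=
  fun h₁ h₂ h₃ ε₁ ε₂ ε₃ hε₁ hh₁ m hm hG =>
    waring_three_card_roots_le_mfree' h₁ h₂ h₃ ε₁ ε₂ ε₃ hε₁ hh₁ m hm hG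

end Summit.ValiantsHypothesis.ValiantsHypothesis.Theorems.RealTauRealTauRefined
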